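import Mathlib
import HarnessLib
import Literature.Analysis.FluidPDE.TypeIAncientMild
import Literature.Analysis.FluidPDE.TypeIAncientMildRssPullback
import Summits.NavierStokesRegularity.NavierStokesRegularity.Theses.ExtremalTypeIConstant
import Summits.NavierStokesRegularity.NavierStokesRegularity.Theses.DulacContraction
import Summits.NavierStokesRegularity.NavierStokesRegularity.Theorems.ExtremalTypeIConstantExtremalSpiralSymmetryPeriodToRDSS
import Summits.NavierStokesRegularity.NavierStokesRegularity.Theorems.ExtremalTypeIConstantExtremalSpiralSymmetryRdssLiouvilleOfInClass
import Summits.NavierStokesRegularity.NavierStokesRegularity.Theorems.ExtremalTypeIConstantExtremalSpiralSymmetryScalingRecurrenceOfCrux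

/-!
# Crux `ExtremalSpiralSymmetry` (stmt-NavierStokesRegularity-8215), line `registered` — structural consequence:
# crux 3 of the route (`SpiralScalingLiouville`, stmt-8216) ALSO follows from the RDSS wall (stmt-8561)

Support file (theorems only, `--supports stmt-NavierStokesRegularity-8215`; no definitions, no named facts). Lead c2.

A one-parameter spiral-scaling symmetry integrates to an exact scaling period: if `u` is differentiable on the open
slab and `∇u·(a + x + Ax) + u + 2t∂ₜu − Au = 0` on `t < 0` with `A` skew, then
`e u(e²t, ex) = R u(t, R⁻¹(x − b))` on `t < 0` with `R = e^{A}` (a linear isometry), `b = e⁻¹x_c − Rx_c`, `x_c` the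
centre `x_c + Ax_c = −a` (`period_of_spiralGenerator`; rotated Euler homogeneity `rss_pull_const` at parameters
`0, 1` — the computation of the landed `stub_scalingRecurrence_of_ExtremalSpiralSymmetry`, freed from the extremal
hypotheses). Consequently (`spiralScalingLiouville_of_rdssLiouvilleInClass`) the route's crux 3
`ExtremalTypeIConstant.SpiralScalingLiouville` (stmt-8216: spiral-scaling-symmetric elements of `A_C` vanish — the
bounded-profile ROTATED self-similar Liouville theorem, open for `A ≠ 0`) follows from crux stmt-8561
(`DulacContraction.RDSSLiouvilleInClass`) through the landed chain period ⇒ RDSS about a centre ⇒ wall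
(`period_trivial_of_rdssLiouville`, `stub_rdssLiouville_of_rdssLiouvilleInClass`). With `…TargetOfRecurrence.lean`:
the whole route `ExtremalTypeIConstant` reduces to its recurrence stub (Conjecture M, recurrence half) and the single
shared wall stmt-8561. CONDITIONAL on stmt-8561 (explicit hypothesis, never asserted).
-/

noncomputable section

-- the summit and its single sub-problem share the name (CONVENTIONS §1), as in every Theorems file
set_option linter.dupNamespace false

open Set MeasureTheory Filter Topology Function
open scoped RealInnerProductSpace
open Literature.Analysis.FluidPDE

namespace Summit.NavierStokesRegularity.NavierStokesRegularity.Theorems.ExtremalSpiralSymmetry.Registered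

/-- **A spiral-scaling generator integrates to an exact scaling period.** If `u` is differentiable on the open slab
`t < 0` and `∇u·(a + x + Ax) + u + 2t ∂ₜu − Au = 0` there with `A` skew (`⟪Ax, x⟫ = 0`), then for the centre `x_c`
(`x_c + A x_c = −a`), the isometry `R = e^{A}` and `b = e⁻¹ x_c − R x_c`:
`e • u (e²t, e • x) = R (u t (R⁻¹ (x − b)))` for all `t < 0`, `x` — an exact period with factor `e ≠ 1` and no time
shift (rotated Euler homogeneity, `rss_pull_const`). [folklore] -/
-- adapted from the landed `stub_scalingRecurrence_of_ExtremalSpiralSymmetry` (…ScalingRecurrenceOfCrux.lean)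
theorem period_of_spiralGenerator {u : ℝ → EuclideanSpace ℝ (Fin 3) → EuclideanSpace ℝ (Fin 3)}
    (hd : DifferentiableOn ℝ (Function.uncurry u) (Set.Iio 0 ×ˢ Set.univ))
    {a : EuclideanSpace ℝ (Fin 3)} {A : EuclideanSpace ℝ (Fin 3) →L[ℝ] EuclideanSpace ℝ (Fin 3)}
    (hA : ∀ x, inner ℝ (A x) x = 0)
    (hgen : ∀ t < 0, ∀ x, fderiv ℝ (u t) x (a + x + A x) + u t x +
      (2 * t) • Literature.Analysis.FluidPDE.timeDeriv u t x - A (u t x) = 0) :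
    ∃ c : ℝ, 0 < c ∧ c ≠ 1 ∧ ∃ (b : EuclideanSpace ℝ (Fin 3))
      (R : EuclideanSpace ℝ (Fin 3) ≃ₗᵢ[ℝ] EuclideanSpace ℝ (Fin 3)),
      ∀ t < (0 : ℝ), ∀ x, c • u (c ^ 2 * t) (c • x) = R (u t (R.symm (x - b))) := by
  obtain ⟨xc, hxc⟩ := exists_centre_of_skew A hA a
  -- the generator in normalised rotated form, vertex `(0, x_c)`, `B = A`
  have hgen' : ∀ t < 0, ∀ x, fderiv ℝ (u t) x ((x - xc) + A (x - xc)) + u t x +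
      (2 * (t - 0)) • timeDeriv u t x - A (u t x) = 0 := by
    intro t ht x
    have e1 : (x - xc) + A (x - xc) = a + x + A x := by
      have ha : a = -(xc + A xc) := by rw [hxc, neg_neg]
      rw [map_sub, ha]
      abel
    rw [e1, sub_zero]
    exact hgen t ht x
  -- the rotation `R = e^{A}` as a linear isometry (`L = e^{-A}`, `L.symm = e^{A}`)
  obtain ⟨L, hL1, hL2⟩ := rss_exists_rot (E := EuclideanSpace ℝ (Fin 3)) hA 1
  refine ⟨Real.exp 1, Real.exp_pos 1, (Real.one_lt_exp_iff.2 one_pos).ne',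
    (Real.exp 1)⁻¹ • xc - L.symm xc, L.symm, fun t ht x => ?_⟩
  rw [LinearIsometryEquiv.symm_symm]
  set y : EuclideanSpace ℝ (Fin 3) := L (x - ((Real.exp 1)⁻¹ • xc - L.symm xc)) with hy
  have h₁ : (0 : ℝ) + Real.exp 0 ^ 2 * t < 0 := by
    rw [zero_add, Real.exp_zero, one_pow, one_mul]; exact ht
  have h₂ : (0 : ℝ) + Real.exp 1 ^ 2 * t < 0 := by
    rw [zero_add]; exact mul_neg_of_pos_of_neg (pow_pos (Real.exp_pos 1) 2) ht
  have key := rss_pull_const (B := A) (θ := 0) (xc := xc) hd hgen' (s := t) y (ρ₁ := 0) (ρ₂ := 1) h₁ h₂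
  rw [rss_pull_zero, zero_add, zero_add, ← hL1, ← hL2] at key
  have hy' : xc + Real.exp 1 • L.symm (y - xc) = Real.exp 1 • x := by
    rw [hy, map_sub, LinearIsometryEquiv.symm_apply_apply, smul_sub, smul_sub, smul_sub, smul_smul,
      mul_inv_cancel₀ (Real.exp_pos 1).ne', one_smul]
    abel
  rw [hy'] at key
  rw [key, map_smul, LinearIsometryEquiv.symm_apply_apply]

/-- **Crux 3 of route `ExtremalTypeIConstant` from the RDSS wall (stmt-8561).** Assuming
`DulacContraction.RDSSLiouvilleInClass` (hypothesis), `ExtremalTypeIConstant.SpiralScalingLiouville` (stmt-8216) holds: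
an element of `A_C` with a spiral-scaling symmetry has an exact scaling period with factor `e` modulo a rigid motion
(`period_of_spiralGenerator`), hence vanishes on `t < 0` by the gauge-class wall (`period_trivial_of_rdssLiouville`
fed with `stub_rdssLiouville_of_rdssLiouvilleInClass`). So the bounded-profile rotated-self-similar Liouville theorem
the route filed as crux 3 is subsumed by the rotated-DSS wall. CONDITIONAL on stmt-8561. [folklore] -/
theorem spiralScalingLiouville_of_rdssLiouvilleInClass :
    _root_.Summit.NavierStokesRegularity.NavierStokesRegularity.Theses.DulacContraction.RDSSLiouvilleInClass →
    _root_.Summit.NavierStokesRegularity.NavierStokesRegularity.Theses.ExtremalTypeIConstant.SpiralScalingLiouville := by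
  intro h8561 C u hcls hsym
  obtain ⟨a, A, hA, hgen⟩ := hsym
  have hd : DifferentiableOn ℝ (Function.uncurry u) (Set.Iio 0 ×ˢ Set.univ) :=
    hcls.1.differentiableOn (by simp)
  obtain ⟨c, hc, hc1, b, R, hper⟩ := period_of_spiralGenerator hd hA hgen
  exact period_trivial_of_rdssLiouville (stub_rdssLiouville_of_rdssLiouvilleInClass h8561) hcls hc hc1 hper

end Summit.NavierStokesRegularity.NavierStokesRegularity.Theorems.ExtremalSpiralSymmetry.Registered

end
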